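import Summits.KontsevichZagierPeriods.KontsevichZagierPeriods.Theorems.BetaCancellation.Negative.PrimitiveCriterion

/-!
# `BetaCancellation` (stmt-KontsevichZagierPeriods-13633) — line `dirichlet-companion-to-pi`, stub `stub_triangleConst`

Helper file of the crux lead (`--supports` stmt-KontsevichZagierPeriods-13633), registered stub
`stub_triangleConst` of the reshaped skeleton (fibred descent by Archimedes' trisection of the unit
disc). The inscribed equilateral triangle of the closed unit disc with vertical side `x = -1/2`,
`T = {(x, y) | -1/2 ≤ x ≤ 1, 3 y² ≤ (1 - x)²}` (vertices `(1, 0)`, `(-1/2, ±√3/2)`, area `3√3/4`),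
carried as the representation `[T, 1]` of dimension `2`, is worth the real-algebraic constant
`κ = 3√3/4` against every factor `s = [σ, f]`: `s × [T, 1] ∼ [σ, κ·f]` in the Kontsevich–Zagier
calculus of `KZCalculus.lean`. The proof is two Newton–Leibniz moves (printed rule (3)) along the
last coordinate:

* in dimension `2 → 1`: `[T, 1] ∼ [[-1/2, 1], 2(1 - x)/√3]` (base the segment `[-1/2, 1]`, edges
  `∓(1 - x)/√3`, primitive `F (x, y) = y`), transported to `s × [T, 1] ∼ s × [[-1/2,1], 2(1-x)/√3]`
  by the compatibility of `∼` with products (`KZ.Equivalent.prod`);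
* in dimension `m + 1 → m`: `s × [[-1/2, 1], k] ∼ [σ, (K 1 - K (-1/2))·f]` with the kernel
  `k x = 2(1 - x)/√3`, its primitive `K x = -(1 - x)²/√3`, and `K 1 - K (-1/2) = 9/(4√3) = 3√3/4`
  (the template `prod_iccRep_sub_constMul_mem_newtonLeibnizRel` of
  `Theorems/BetaCancellation/Negative/PrimitiveCriterion.lean`, over the base segment `[-1/2, 1]`).

All constants are written through `√3/3 = 1/√3`, a root of `X² - 1/3 ∈ ℚ[X]`. No definitions are
introduced: the two moves are stated for arbitrary representations with the prescribed domains and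
integrands (`[T, 1]`, `[[-1/2, 1], k]`, `[[-1/2, 1], K]`), which the stub then instantiates.

References: M. Kontsevich, D. Zagier, *Periods* (2001), §1.1 (eq. (1): `π = ∬_{x²+y²≤1} dx dy`),
§1.2 (rules (1)–(3)); Archimedes, *Measurement of a circle*, Prop. 1 (inscribed polygons).
-/

noncomputable section

-- `Summit.KontsevichZagierPeriods.KontsevichZagierPeriods.…` is the tree's mandated layout (single-conjunct summit).
set_option linter.dupNamespace false

namespace Summit.KontsevichZagierPeriods.KontsevichZagierPeriods.BetaCancellationLine

open Set MeasureTheory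
open Literature.NumberTheory.Transcendental
open Literature.NumberTheory.Transcendental.KZ
open Literature.ModelTheory.ExponentialFields (IsSemialgebraic isSemialgebraic_setOf_eval_nonneg)
open MvPolynomial (aeval X C)
open Summit.KontsevichZagierPeriods.KontsevichZagierPeriods.BetaCancellationNegative
  (natAdd_zero_eq_last init_eq_comp_castAdd)

/-! ## The constant `1/√3 = √3/3`, the kernel and its primitive -/

/-- `(√3/3)² = 1/3`. [folklore] -/
theorem sqrt_three_div_three_sq : (Real.sqrt 3 / 3) ^ 2 = 1 / 3 := by
  rw [div_pow, Real.sq_sqrt (by norm_num)]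
  norm_num

/-- `0 ≤ √3/3`. [folklore] -/
theorem sqrt_three_div_three_nonneg : 0 ≤ Real.sqrt 3 / 3 :=
  div_nonneg (Real.sqrt_nonneg 3) (by norm_num)

/-- `√3/3` is algebraic over `ℚ` (a root of `X² - 1/3`). [folklore] -/
theorem isAlgebraic_sqrt_three_div_three : IsAlgebraic ℚ (Real.sqrt 3 / 3) := by
  refine ⟨Polynomial.X ^ 2 - Polynomial.C (1 / 3 : ℚ),
    Polynomial.X_pow_sub_C_ne_zero (by norm_num) _, ?_⟩
  simp only [map_sub, map_pow, Polynomial.aeval_X, Polynomial.aeval_C, eq_ratCast,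
    sqrt_three_div_three_sq]
  push_cast
  ring

/-- `K' = k`: the primitive `K x = -(1 - x)²/√3` of the kernel `k x = 2(1 - x)/√3`. [folklore] -/
theorem hasDerivAt_prim (t : ℝ) :
    HasDerivAt (fun t : ℝ => -(1 - t) ^ 2 * (Real.sqrt 3 / 3))
      (2 * (1 - t) * (Real.sqrt 3 / 3)) t := by
  have h1 : HasDerivAt (fun t : ℝ => 1 - t) (-1) t := by
    simpa using (hasDerivAt_id t).const_sub 1
  have h2 : HasDerivAt (fun t : ℝ => -(1 - t) ^ 2 * (Real.sqrt 3 / 3))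
      (-(((2 : ℕ) : ℝ) * (1 - t) ^ (2 - 1) * (-1)) * (Real.sqrt 3 / 3)) t :=
    ((h1.pow 2).neg).mul_const _
  convert h2 using 1
  norm_num

/-! ## The base segment `[-1/2, 1] ⊆ ℝ¹` -/

/-- `[-1/2, 1] ⊆ ℝ¹` (the projection of the triangle to the `x`-axis) is `ℚ`-semialgebraic: two
polynomial inequalities. [folklore] -/
theorem isSemialgebraic_seg : IsSemialgebraic ℚ {x : Fin 1 → ℝ | -1 / 2 ≤ x 0 ∧ x 0 ≤ 1} := by
  have h1 := isSemialgebraic_setOf_eval_nonneg (k := ℚ) (R := ℝ)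
    (2 * X 0 + 1 : MvPolynomial (Fin 1) ℚ)
  have h2 := isSemialgebraic_setOf_eval_nonneg (k := ℚ) (R := ℝ)
    (1 - X 0 : MvPolynomial (Fin 1) ℚ)
  have h := h1.inter h2
  simp only [map_add, map_sub, map_mul, map_one, map_ofNat, MvPolynomial.aeval_X] at h
  have hset : {x : Fin 1 → ℝ | -1 / 2 ≤ x 0 ∧ x 0 ≤ 1} =
      {x : Fin 1 → ℝ | 0 ≤ 2 * x 0 + 1} ∩ {x | 0 ≤ 1 - x 0} := by
    ext x
    simp only [mem_inter_iff, mem_setOf_eq]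
    constructor
    · rintro ⟨h1, h2⟩
      exact ⟨by linarith, by linarith⟩
    · rintro ⟨h1, h2⟩
      exact ⟨by linarith, by linarith⟩
  rw [hset]
  exact h

/-- `[-1/2, 1] ⊆ ℝ¹` is compact (it is the closed box `Icc (-1/2) 1`). [folklore] -/
theorem isCompact_seg : IsCompact {x : Fin 1 → ℝ | -1 / 2 ≤ x 0 ∧ x 0 ≤ 1} := by
  have hset : {x : Fin 1 → ℝ | -1 / 2 ≤ x 0 ∧ x 0 ≤ 1} =
      Icc (fun _ : Fin 1 => (-1 / 2 : ℝ)) (fun _ => 1) := by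
    ext x
    simp only [mem_setOf_eq, mem_Icc, Pi.le_def, Fin.forall_fin_one]
  rw [hset]
  exact isCompact_Icc

/-- A polynomial over `ℚ` times the algebraic constant `√3/3` is `ℚ`-semialgebraic on the base
segment. [folklore] -/
theorem isSemialgebraicFunOn_aeval_mul_sqrt_three_div_three (p : MvPolynomial (Fin 1) ℚ) :
    IsSemialgebraicFunOn ℚ {x : Fin 1 → ℝ | -1 / 2 ≤ x 0 ∧ x 0 ≤ 1}
      (fun x => aeval x p * (Real.sqrt 3 / 3)) :=
  IsSemialgebraicFunOn.mul_holds (isSemialgebraicFunOn_aeval isSemialgebraic_seg p)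
    (isSemialgebraicFunOn_const_of_isAlgebraic isSemialgebraic_seg
      isAlgebraic_sqrt_three_div_three)

/-- The upper edge `x ↦ (1 - x)/√3` of the triangle is `ℚ`-semialgebraic on the base segment.
[folklore] -/
theorem isSemialgebraicFunOn_edge :
    IsSemialgebraicFunOn ℚ {x : Fin 1 → ℝ | -1 / 2 ≤ x 0 ∧ x 0 ≤ 1}
      (fun x => (1 - x 0) * (Real.sqrt 3 / 3)) :=
  (isSemialgebraicFunOn_aeval_mul_sqrt_three_div_three (1 - X 0)).congr fun x _ => by simp

/-- The kernel `k x = 2(1 - x)/√3` (the length of the fibre of the triangle over `x`) is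
`ℚ`-semialgebraic on the base segment. [folklore] -/
theorem isSemialgebraicFunOn_ker :
    IsSemialgebraicFunOn ℚ {x : Fin 1 → ℝ | -1 / 2 ≤ x 0 ∧ x 0 ≤ 1}
      (fun x => 2 * (1 - x 0) * (Real.sqrt 3 / 3)) :=
  (isSemialgebraicFunOn_aeval_mul_sqrt_three_div_three (2 * (1 - X 0))).congr fun x _ => by simp

/-- The primitive `K x = -(1 - x)²/√3` of the kernel is `ℚ`-semialgebraic on the base segment.
[folklore] -/
theorem isSemialgebraicFunOn_prim :
    IsSemialgebraicFunOn ℚ {x : Fin 1 → ℝ | -1 / 2 ≤ x 0 ∧ x 0 ≤ 1}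
      (fun x => -(1 - x 0) ^ 2 * (Real.sqrt 3 / 3)) :=
  (isSemialgebraicFunOn_aeval_mul_sqrt_three_div_three (-(1 - X 0) ^ 2)).congr fun x _ => by simp

/-- The kernel is absolutely integrable on the base segment (continuous on a compact set).
[folklore] -/
theorem integrableOn_ker :
    IntegrableOn (fun x : Fin 1 → ℝ => 2 * (1 - x 0) * (Real.sqrt 3 / 3))
      {x : Fin 1 → ℝ | -1 / 2 ≤ x 0 ∧ x 0 ≤ 1} :=
  (Continuous.continuousOn (by fun_prop)).integrableOn_compact isCompact_seg

/-- The primitive is absolutely integrable on the base segment (continuous on a compact set).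
[folklore] -/
theorem integrableOn_prim :
    IntegrableOn (fun x : Fin 1 → ℝ => -(1 - x 0) ^ 2 * (Real.sqrt 3 / 3))
      {x : Fin 1 → ℝ | -1 / 2 ≤ x 0 ∧ x 0 ≤ 1} :=
  (Continuous.continuousOn (by fun_prop)).integrableOn_compact isCompact_seg

/-- The integrand of `s × r`, `r` of dimension `1`, on a fibre `Fin.snoc x t` is `f x · g t`.
[folklore] -/
theorem prod_integrand_snoc {m : ℕ} (s : IntegralRep m) (r : IntegralRep 1) (x : Fin m → ℝ)
    (t : ℝ) : (s.prod r).integrand (Fin.snoc x t) = s.integrand x * r.integrand (fun _ => t) := by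
  rw [IntegralRep.prod_integrand_eq]
  simp only [IntegralRep.prodFun]
  congr 1
  · congr 1
    funext i
    exact Fin.snoc_castSucc (α := fun _ => ℝ) t x i
  · congr 1
    funext j
    rw [Fin.fin_one_eq_zero j, natAdd_zero_eq_last, Fin.snoc_last]

/-! ## The triangle -/

/-- The inscribed equilateral triangle `T = {-1/2 ≤ x ≤ 1, 3 y² ≤ (1 - x)²}` of the closed unit
disc (vertices `(1, 0)`, `(-1/2, ±√3/2)`) is `ℚ`-semialgebraic: three polynomial inequalities.
[folklore] -/
theorem isSemialgebraic_tri :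
    IsSemialgebraic ℚ {z : Fin 2 → ℝ | -1 / 2 ≤ z 0 ∧ z 0 ≤ 1 ∧ 3 * z 1 ^ 2 ≤ (1 - z 0) ^ 2} := by
  have h1 := isSemialgebraic_setOf_eval_nonneg (k := ℚ) (R := ℝ)
    (2 * X 0 + 1 : MvPolynomial (Fin 2) ℚ)
  have h2 := isSemialgebraic_setOf_eval_nonneg (k := ℚ) (R := ℝ)
    (1 - X 0 : MvPolynomial (Fin 2) ℚ)
  have h3 := isSemialgebraic_setOf_eval_nonneg (k := ℚ) (R := ℝ)
    ((1 - X 0) ^ 2 - 3 * X 1 ^ 2 : MvPolynomial (Fin 2) ℚ)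
  have h := (h1.inter h2).inter h3
  simp only [map_add, map_sub, map_mul, map_pow, map_one, map_ofNat, MvPolynomial.aeval_X] at h
  have hset : {z : Fin 2 → ℝ | -1 / 2 ≤ z 0 ∧ z 0 ≤ 1 ∧ 3 * z 1 ^ 2 ≤ (1 - z 0) ^ 2} =
      ({z : Fin 2 → ℝ | 0 ≤ 2 * z 0 + 1} ∩ {z | 0 ≤ 1 - z 0}) ∩
        {z | 0 ≤ (1 - z 0) ^ 2 - 3 * z 1 ^ 2} := by
    ext z
    simp only [mem_inter_iff, mem_setOf_eq]
    constructor
    · rintro ⟨h1, h2, h3⟩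
      exact ⟨⟨by linarith, by linarith⟩, by linarith⟩
    · rintro ⟨⟨h1, h2⟩, h3⟩
      exact ⟨by linarith, by linarith, by linarith⟩
  rw [hset]
  exact h

/-- The triangle lies in the square `[-1, 1]²`. [folklore] -/
theorem tri_subset_Icc :
    {z : Fin 2 → ℝ | -1 / 2 ≤ z 0 ∧ z 0 ≤ 1 ∧ 3 * z 1 ^ 2 ≤ (1 - z 0) ^ 2} ⊆
      Icc (fun _ : Fin 2 => (-1 : ℝ)) (fun _ => 1) := by
  rintro z ⟨h1, h2, h3⟩
  have h4 : z 1 ^ 2 ≤ 1 ^ 2 := by nlinarith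
  have h5 := abs_le_of_sq_le_sq' h4 zero_le_one
  simp only [mem_Icc, Pi.le_def, Fin.forall_fin_two]
  exact ⟨⟨by linarith, h5.1⟩, h2, h5.2⟩

/-- The constant `1` is `ℚ`-semialgebraic on the triangle. [folklore] -/
theorem isSemialgebraicFunOn_one_tri :
    IsSemialgebraicFunOn ℚ {z : Fin 2 → ℝ | -1 / 2 ≤ z 0 ∧ z 0 ≤ 1 ∧ 3 * z 1 ^ 2 ≤ (1 - z 0) ^ 2}
      (fun _ => (1 : ℝ)) := by
  simpa using isSemialgebraicFunOn_aeval isSemialgebraic_tri (1 : MvPolynomial (Fin 2) ℚ)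

/-- The constant `1` is absolutely integrable on the (bounded) triangle. [folklore] -/
theorem integrableOn_one_tri :
    IntegrableOn (fun _ : Fin 2 → ℝ => (1 : ℝ))
      {z : Fin 2 → ℝ | -1 / 2 ≤ z 0 ∧ z 0 ≤ 1 ∧ 3 * z 1 ^ 2 ≤ (1 - z 0) ^ 2} :=
  integrableOn_const ((measure_mono tri_subset_Icc).trans_lt measure_Icc_lt_top).ne

/-! ## Move 1: `[T, 1] ∼ [[-1/2, 1], k]` (Newton–Leibniz in dimension `2 → 1`) -/

/-- **`[T, 1] − [[-1/2, 1], 2(1 - x)/√3]` is one Newton–Leibniz move** (for any representations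
`T`, `K` with these domains and integrands): base `[-1/2, 1]`, edges
`a x = -(1 - x)/√3 ≤ b x = (1 - x)/√3`, primitive `F (x, y) = y` (`∂F/∂y = 1`,
`F (x, b x) - F (x, a x) = 2(1 - x)/√3`). [cite: KontsevichZagier2001, §1.2 rule (3)] -/
theorem of_sub_of_mem_newtonLeibnizRel_of_triangle (T : IntegralRep 2) (K : IntegralRep 1)
    (hTd : T.domain = {z : Fin 2 → ℝ | -1 / 2 ≤ z 0 ∧ z 0 ≤ 1 ∧ 3 * z 1 ^ 2 ≤ (1 - z 0) ^ 2})
    (hTi : T.integrand = fun _ => 1)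
    (hKd : K.domain = {x : Fin 1 → ℝ | -1 / 2 ≤ x 0 ∧ x 0 ≤ 1})
    (hKi : K.integrand = fun x => 2 * (1 - x 0) * (Real.sqrt 3 / 3)) :
    of T - of K ∈ newtonLeibnizRel := by
  refine ⟨1, T, K, fun x => -((1 - x 0) * (Real.sqrt 3 / 3)),
    fun x => (1 - x 0) * (Real.sqrt 3 / 3), fun z => z (Fin.last 1), ?_, ?_, ?_, ?_, ?_, ?_, ?_,
    ?_, rfl⟩
  · -- `F (x, y) = y` is a coordinate, hence semialgebraic on the triangle
    rw [hTd]
    exact (isSemialgebraicFunOn_aeval isSemialgebraic_tri (X (Fin.last 1))).congr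
      fun z _ => by simp
  · -- the lower edge `a = -b`
    rw [hKd]
    exact isSemialgebraicFunOn_edge.neg
  · -- the upper edge `b`
    rw [hKd]
    exact isSemialgebraicFunOn_edge
  · -- `a ≤ b` on the base
    intro x hx
    rw [hKd] at hx
    have hu : 0 ≤ (1 - x 0) * (Real.sqrt 3 / 3) :=
      mul_nonneg (by linarith [hx.2]) sqrt_three_div_three_nonneg
    linarith
  · -- the triangle is the band `{a x ≤ y ≤ b x}` over the base segment
    rw [hTd, hKd]
    ext z
    have e0 : Fin.init z 0 = z 0 := rfl
    have e1 : z (Fin.last 1) = z 1 := rfl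
    simp only [mem_setOf_eq, e0, e1]
    have hsq : ((1 - z 0) * (Real.sqrt 3 / 3)) ^ 2 = (1 - z 0) ^ 2 * (1 / 3) := by
      rw [mul_pow, sqrt_three_div_three_sq]
    constructor
    · rintro ⟨h1, h2, h3⟩
      have hu : 0 ≤ (1 - z 0) * (Real.sqrt 3 / 3) :=
        mul_nonneg (by linarith) sqrt_three_div_three_nonneg
      have h4 : z 1 ^ 2 ≤ ((1 - z 0) * (Real.sqrt 3 / 3)) ^ 2 := by
        rw [hsq]
        linarith
      exact ⟨⟨h1, h2⟩, abs_le_of_sq_le_sq' h4 hu⟩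
    · rintro ⟨⟨h1, h2⟩, h3, h4⟩
      have h5 := sq_le_sq' h3 h4
      rw [hsq] at h5
      exact ⟨h1, h2, by linarith⟩
  · -- continuity of `y ↦ F (x, y) = y` on the closed fibre
    intro x _
    simp only [Fin.snoc_last]
    fun_prop
  · -- `∂F/∂y = 1` is the integrand of `[T, 1]`
    intro x _ t _
    simp only [Fin.snoc_last, hTi]
    exact hasDerivAt_id' t
  · -- the boundary term is the kernel
    intro x _
    simp only [Fin.snoc_last, hKi]
    ring

/-! ## Move 2: `s × [[-1/2, 1], k] ∼ [σ, (3√3/4)·f]` (Newton–Leibniz in dimension `m + 1 → m`) -/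

/-- **`s × [[-1/2, 1], k] − [σ, (3√3/4)·f]` is one Newton–Leibniz move** over the arbitrary base
`s = [σ, f]` (for any representations `K = [[-1/2, 1], k]`, `P = [[-1/2, 1], K]` with these
domains and integrands): constant edges `-1/2 ≤ 1`, primitive `F = f ⊗ K`, `K x = -(1 - x)²/√3`,
`K 1 - K (-1/2) = 3√3/4`. [cite: KontsevichZagier2001, §1.2 rule (3)] -/
theorem of_prod_sub_of_constMul_mem_newtonLeibnizRel_of_kernel {m : ℕ} (s : IntegralRep m)
    (K P : IntegralRep 1) (hKd : K.domain = {x : Fin 1 → ℝ | -1 / 2 ≤ x 0 ∧ x 0 ≤ 1})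
    (hKi : K.integrand = fun x => 2 * (1 - x 0) * (Real.sqrt 3 / 3))
    (hPd : P.domain = {x : Fin 1 → ℝ | -1 / 2 ≤ x 0 ∧ x 0 ≤ 1})
    (hPi : P.integrand = fun x => -(1 - x 0) ^ 2 * (Real.sqrt 3 / 3))
    (ha : IsAlgebraic ℚ (3 * Real.sqrt 3 / 4)) :
    of (s.prod K) - of (s.constMul (3 * Real.sqrt 3 / 4) ha) ∈ newtonLeibnizRel := by
  have hdom : (s.prod K).domain = (s.prod P).domain := by
    ext z
    simp only [IntegralRep.prod_domain, IntegralRep.mem_prodDomain, hKd, hPd]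
  refine ⟨m, s.prod K, s.constMul (3 * Real.sqrt 3 / 4) ha, fun _ => (-1 / 2 : ℝ),
    fun _ => (1 : ℝ), (s.prod P).integrand, ?_, ?_, ?_, fun _ _ => by norm_num, ?_, ?_, ?_, ?_,
    rfl⟩
  · -- `F = f ⊗ K` is the integrand of a product representation, hence semialgebraic
    rw [hdom]
    exact (s.prod P).isSemialgebraicFunOn_integrand
  · -- `a = -1/2` is semialgebraic on `σ`
    exact (isSemialgebraicFunOn_aeval s.isSemialgebraic_domain
      (C (-1 / 2 : ℚ) : MvPolynomial (Fin m) ℚ)).congr fun x _ => by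
        simp only [MvPolynomial.aeval_C, eq_ratCast]
        norm_num
  · -- `b = 1` is semialgebraic on `σ`
    exact (isSemialgebraicFunOn_aeval s.isSemialgebraic_domain
      (1 : MvPolynomial (Fin m) ℚ)).congr fun x _ => by simp
  · -- `σ × [-1/2, 1]` is the band with constant edges over `σ`
    ext z
    simp only [IntegralRep.prod_domain, IntegralRep.mem_prodDomain, hKd,
      IntegralRep.domain_constMul, mem_setOf_eq, init_eq_comp_castAdd, natAdd_zero_eq_last]
  · -- continuity of `t ↦ f x · K t` on the closed fibre
    intro x _
    simp only [prod_integrand_snoc, hPi]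
    fun_prop
  · -- `∂/∂t (f x · K t) = f x · k t`
    intro x _ t _
    have hF : (fun t : ℝ => (s.prod P).integrand (Fin.snoc x t)) =
        fun t => s.integrand x * (-(1 - t) ^ 2 * (Real.sqrt 3 / 3)) := by
      funext t
      simp only [prod_integrand_snoc, hPi]
    have hk : (s.prod K).integrand (Fin.snoc x t) =
        s.integrand x * (2 * (1 - t) * (Real.sqrt 3 / 3)) := by
      simp only [prod_integrand_snoc, hKi]
    rw [hF, hk]
    exact (hasDerivAt_prim t).const_mul (s.integrand x)
  · -- the boundary term: `(3√3/4) f x = f x · K 1 - f x · K (-1/2)`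
    intro x _
    simp only [prod_integrand_snoc, hPi, IntegralRep.integrand_constMul]
    ring

/-! ## The stub -/

/-- **STUB `stub_triangleConst`** (registered stub of the `dirichlet-companion-to-pi` skeleton of
crux `BetaCancellation`): the inscribed equilateral triangle `T` with vertical side `x = -1/2`,
as the representation `[T, 1]`, is worth `3√3/4` against any factor:
`s × [T, 1] ∼ [σ, (3√3/4)·f]` for every representation `s = [σ, f]`. [folklore] -/
theorem stub_triangleConst :
    ∃ T : IntegralRep 2, T.domain = {z : Fin 2 → ℝ | -1/2 ≤ z 0 ∧ z 0 ≤ 1 ∧ 3 * z 1 ^ 2 ≤ (1 - z 0) ^ 2} ∧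
      (T.integrand = fun _ => 1) ∧
      ∀ (ha : IsAlgebraic ℚ (3 * Real.sqrt 3 / 4)) (m : ℕ) (s : IntegralRep m),
        Equivalent (s.prod T) (s.constMul (3 * Real.sqrt 3 / 4) ha) :=
  let T : IntegralRep 2 :=
    ⟨{z : Fin 2 → ℝ | -1 / 2 ≤ z 0 ∧ z 0 ≤ 1 ∧ 3 * z 1 ^ 2 ≤ (1 - z 0) ^ 2}, fun _ => 1,
      isSemialgebraic_tri, isSemialgebraicFunOn_one_tri, integrableOn_one_tri⟩
  let K : IntegralRep 1 :=
    ⟨{x : Fin 1 → ℝ | -1 / 2 ≤ x 0 ∧ x 0 ≤ 1}, fun x => 2 * (1 - x 0) * (Real.sqrt 3 / 3),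
      isSemialgebraic_seg, isSemialgebraicFunOn_ker, integrableOn_ker⟩
  let P : IntegralRep 1 :=
    ⟨{x : Fin 1 → ℝ | -1 / 2 ≤ x 0 ∧ x 0 ≤ 1}, fun x => -(1 - x 0) ^ 2 * (Real.sqrt 3 / 3),
      isSemialgebraic_seg, isSemialgebraicFunOn_prim, integrableOn_prim⟩
  ⟨T, rfl, rfl, fun ha _ s =>
    (Equivalent.prod (Equivalent.refl s) (newtonLeibnizRel_subset_relations
      (of_sub_of_mem_newtonLeibnizRel_of_triangle T K rfl rfl rfl rfl))).trans
      (newtonLeibnizRel_subset_relations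
        (of_prod_sub_of_constMul_mem_newtonLeibnizRel_of_kernel s K P rfl rfl rfl rfl ha))⟩

end Summit.KontsevichZagierPeriods.KontsevichZagierPeriods.BetaCancellationLine
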